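import Literature.Analysis.FluidPDE.FiniteFourierModeEulerPolygonA

/-!
# Kishimoto–Yoneda §3 (planar case): horizontal / vertical coordinates

Support file for `FiniteFourierModeEuler` (N. Kishimoto, T. Yoneda, J. Math. Fluid Mech. 24
(2022) 74 = arXiv:2110.08039), §3. When the Fourier support `S` lies in a plane `P = e^⊥`
through the origin, every divergence-free coefficient vector at `n ∈ S` decomposes as
`u_n = α_n (e × n) + w_n e` ("`u = u^∥ + u^⊥ e^⊥`"): the horizontal part `u^∥_n` is a complex
multiple of `e × n` and the vertical part is the complex scalar `w_n`. We set up these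
coordinates (`vert`, `hcoef`, `horiz`) and compute the pair bracket in them:
`(u₁·n₂)u₂ + (u₂·n₁)u₁ = τ₁₂ (α₁ u₂ - α₂ u₁)` with `τ₁₂ = e·(n₁ × n₂)`, its vertical component
`τ₁₂ (α₁ w₂ - α₂ w₁) |e|²`, and the commutation of the Helmholtz projection `P̂_n` (`n ⊥ e`)
with the horizontal/vertical splitting.

## References

* [KishimotoYoneda2022] N. Kishimoto, T. Yoneda, J. Math. Fluid Mech. 24 (2022) 74 =
  arXiv:2110.08039, §3 (the decomposition `u = u^∥ + u^⊥ e^⊥`, (cond:parallel), (cond:Euler^h)).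
-/

noncomputable section

open Matrix Finset Complex

namespace Literature.Analysis.FluidPDE

namespace KY

/-! ### Complex vectors orthogonal to three independent real vectors vanish -/

/-- Two linear functionals agreeing on three linearly independent vectors agree everywhere
(a copy of `functional_eq_of_eq_on_triple` of `FiniteFourierModeEulerFacetsA`, repeated here to keep
the planar files independent of the three-dimensional chain). [folklore] -/
private theorem functional_eq_of_eq_on_triple' {φ φ' a b c : Fin 3 → ℝ} (habc : a ⬝ᵥ (b ⨯₃ c) ≠ 0)
    (ha : φ ⬝ᵥ a = φ' ⬝ᵥ a) (hb : φ ⬝ᵥ b = φ' ⬝ᵥ b) (hc : φ ⬝ᵥ c = φ' ⬝ᵥ c) : φ = φ' := by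
  -- `[a,b,c] (φ·x) = [x,b,c] φ·a + [a,x,c] φ·b + [a,b,x] φ·c`
  have key : ∀ x : Fin 3 → ℝ, φ ⬝ᵥ x = φ' ⬝ᵥ x := by
    intro x
    have h1 := congrArg (fun v => φ ⬝ᵥ v) (cramer_triple a b c x)
    have h2 := congrArg (fun v => φ' ⬝ᵥ v) (cramer_triple a b c x)
    simp only [dotProduct_smul, dotProduct_add, smul_eq_mul] at h1 h2
    rw [ha, hb, hc, ← h2] at h1
    exact mul_left_cancel₀ habc h1
  -- a vector is determined by its pairings
  have : ∀ i, φ i = φ' i := by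
    intro i
    have := key (Pi.single i 1)
    simpa [dotProduct_single] using this
  exact funext this

/-- The real part of the bilinear pairing with a real vector. [folklore] -/
theorem re_dot_cplx (b : Fin 3 → ℝ) (z : Fin 3 → ℂ) :
    (dot (cplx b) z).re = b ⬝ᵥ fun i => (z i).re := by
  simp [dot_eq, real_dot_eq, cplx_apply]

/-- The imaginary part of the bilinear pairing with a real vector. [folklore] -/
theorem im_dot_cplx (b : Fin 3 → ℝ) (z : Fin 3 → ℂ) :
    (dot (cplx b) z).im = b ⬝ᵥ fun i => (z i).im := by
  simp [dot_eq, real_dot_eq, cplx_apply]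

/-- A complex vector with vanishing bilinear pairings against three linearly independent real
vectors is zero. [folklore] -/
theorem eq_zero_of_dot_triple {b₁ b₂ b₃ : Fin 3 → ℝ} (hb : b₁ ⬝ᵥ (b₂ ⨯₃ b₃) ≠ 0) {z : Fin 3 → ℂ}
    (h₁ : dot (cplx b₁) z = 0) (h₂ : dot (cplx b₂) z = 0) (h₃ : dot (cplx b₃) z = 0) : z = 0 := by
  have hre : (fun i => (z i).re) = (0 : Fin 3 → ℝ) := by
    apply functional_eq_of_eq_on_triple' hb
    · rw [zero_dotProduct, dotProduct_comm, ← re_dot_cplx, h₁, Complex.zero_re]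
    · rw [zero_dotProduct, dotProduct_comm, ← re_dot_cplx, h₂, Complex.zero_re]
    · rw [zero_dotProduct, dotProduct_comm, ← re_dot_cplx, h₃, Complex.zero_re]
  have him : (fun i => (z i).im) = (0 : Fin 3 → ℝ) := by
    apply functional_eq_of_eq_on_triple' hb
    · rw [zero_dotProduct, dotProduct_comm, ← im_dot_cplx, h₁, Complex.zero_im]
    · rw [zero_dotProduct, dotProduct_comm, ← im_dot_cplx, h₂, Complex.zero_im]
    · rw [zero_dotProduct, dotProduct_comm, ← im_dot_cplx, h₃, Complex.zero_im]
  funext i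
  apply Complex.ext
  · exact congrFun hre i
  · exact congrFun him i

/-! ### The coordinates -/

/-- The vertical coordinate `w = (e·z)/|e|²` of `z ∈ ℂ³` (`z = … + w e`).
[cite: KishimotoYoneda2022, §3 (`u = u^∥ + u^⊥ e^⊥`)] -/
def vert (e : Fin 3 → ℝ) (z : Fin 3 → ℂ) : ℂ := dot (cplx e) z / dot (cplx e) (cplx e)

/-- The horizontal coordinate `α = ((e × n)·z)/|e × n|²` of `z` at the planar frequency `n`
(`u^∥_n = α_n (e × n)`). [cite: KishimotoYoneda2022, §3 ((rep:horizontal): `u^∥_n = α e^∥`)] -/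
def hcoef (e n : Fin 3 → ℝ) (z : Fin 3 → ℂ) : ℂ :=
  dot (cplx (e ⨯₃ n)) z / dot (cplx (e ⨯₃ n)) (cplx (e ⨯₃ n))

/-- The horizontal part `z - w e` of `z`. [cite: KishimotoYoneda2022, §3 (`u^∥`)] -/
def horiz (e : Fin 3 → ℝ) (z : Fin 3 → ℂ) : Fin 3 → ℂ := z - vert e z • cplx e

/-- The planar cross pairing `τ(a, b) = e·(a × b)`. [folklore] -/
def pc (e a b : Fin 3 → ℝ) : ℝ := e ⬝ᵥ (a ⨯₃ b)

section Basic

variable {e n : Fin 3 → ℝ}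

/-- Algebra of the planar cross pairing: `pc_anticomm`. [folklore] -/
theorem pc_anticomm (e a b : Fin 3 → ℝ) : pc e b a = -pc e a b := by
  unfold pc; rw [← cross_anticomm, dotProduct_neg]

/-- Simp bookkeeping: `pc_self`. [folklore] -/
@[simp] theorem pc_self (e a : Fin 3 → ℝ) : pc e a a = 0 := by
  unfold pc; rw [cross_self, dotProduct_zero]

/-- Linearity rule `pc_add_right`. [folklore] -/
theorem pc_add_right (e a b c : Fin 3 → ℝ) : pc e a (b + c) = pc e a b + pc e a c := by
  unfold pc; rw [map_add, dotProduct_add]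

/-- Linearity rule `pc_add_left`. [folklore] -/
theorem pc_add_left (e a b c : Fin 3 → ℝ) : pc e (a + b) c = pc e a c + pc e b c := by
  unfold pc; rw [map_add, LinearMap.add_apply, dotProduct_add]

/-- Linearity rule `pc_smul_right`. [folklore] -/
theorem pc_smul_right (e a b : Fin 3 → ℝ) (r : ℝ) : pc e a (r • b) = r * pc e a b := by
  unfold pc; rw [map_smul, dotProduct_smul, smul_eq_mul]

/-- Linearity rule `pc_smul_left`. [folklore] -/
theorem pc_smul_left (e a b : Fin 3 → ℝ) (r : ℝ) : pc e (r • a) b = r * pc e a b := by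
  unfold pc; rw [map_smul, LinearMap.smul_apply, dotProduct_smul, smul_eq_mul]

/-- Linearity rule `pc_neg_left`. [folklore] -/
theorem pc_neg_left (e a b : Fin 3 → ℝ) : pc e (-a) b = -pc e a b := by
  unfold pc; rw [map_neg, LinearMap.neg_apply, dotProduct_neg]

/-- Linearity rule `pc_neg_right`. [folklore] -/
theorem pc_neg_right (e a b : Fin 3 → ℝ) : pc e a (-b) = -pc e a b := by
  unfold pc; rw [map_neg, dotProduct_neg]

/-- Linearity rule `pc_sub_right`. [folklore] -/
theorem pc_sub_right (e a b c : Fin 3 → ℝ) : pc e a (b - c) = pc e a b - pc e a c := by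
  rw [sub_eq_add_neg, pc_add_right, pc_neg_right, ← sub_eq_add_neg]

/-- Linearity rule `pc_sub_left`. [folklore] -/
theorem pc_sub_left (e a b c : Fin 3 → ℝ) : pc e (a - b) c = pc e a c - pc e b c := by
  rw [sub_eq_add_neg, pc_add_left, pc_neg_left, ← sub_eq_add_neg]

/-- `τ(a, b) = (e × a)·b`. [folklore] -/
theorem pc_eq_cross_dot (e a b : Fin 3 → ℝ) : pc e a b = (e ⨯₃ a) ⬝ᵥ b := by
  unfold pc; simp [cross_apply, dotProduct, Fin.sum_univ_three]; ring

/-- For planar `n₁, n₂` (`⊥ e`), `n₁ × n₂ = (τ₁₂/|e|²) e`: the cross product is vertical. [folklore] -/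
theorem cross_planar (he : e ≠ 0) {n₁ n₂ : Fin 3 → ℝ} (h₁ : e ⬝ᵥ n₁ = 0) (h₂ : e ⬝ᵥ n₂ = 0) :
    n₁ ⨯₃ n₂ = (pc e n₁ n₂ / (e ⬝ᵥ e)) • e := by
  have hee : e ⬝ᵥ e ≠ 0 := real_dot_self_ne_zero he
  -- `e × (n₁ × n₂) = 0`, hence `n₁ × n₂ ∥ e`
  have h0 : (n₁ ⨯₃ n₂) ⨯₃ e = 0 := by
    rw [cross_cross_eq_smul_sub_smul, dotProduct_comm, h₁, dotProduct_comm, h₂, zero_smul, zero_smul,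
      sub_self]
  have := eq_smul_of_cross_eq_zero he h0
  rw [this]; unfold pc; rfl

/-- `|e × n|² = |e|²|n|²` for `n ⊥ e`. [folklore] -/
theorem cross_normal_sq (h : e ⬝ᵥ n = 0) : (e ⨯₃ n) ⬝ᵥ (e ⨯₃ n) = (e ⬝ᵥ e) * (n ⬝ᵥ n) := by
  rw [cross_dot_cross, dotProduct_comm n e, h]; ring

/-- Auxiliary fact `cross_normal_ne_zero`. [folklore] -/
theorem cross_normal_ne_zero (he : e ≠ 0) (hn : n ≠ 0) (h : e ⬝ᵥ n = 0) : e ⨯₃ n ≠ 0 := by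
  intro h0
  have := cross_normal_sq h
  rw [h0, zero_dotProduct] at this
  rcases mul_eq_zero.1 this.symm with h1 | h1
  · exact he (dotProduct_self_eq_zero.1 h1)
  · exact hn (dotProduct_self_eq_zero.1 h1)

/-- `(e × n) × e = |e|² n` for `n ⊥ e`. [folklore] -/
theorem cross_normal_cross (h : e ⬝ᵥ n = 0) : (e ⨯₃ n) ⨯₃ e = (e ⬝ᵥ e) • n := by
  rw [cross_cross_eq_smul_sub_smul, dotProduct_comm n e, h, zero_smul, sub_zero]

/-- The triple `(n, e × n, e)` is positively oriented: `[n, e × n, e] = |e|²|n|²`. [folklore] -/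
theorem triple_frame (h : e ⬝ᵥ n = 0) : n ⬝ᵥ ((e ⨯₃ n) ⨯₃ e) = (e ⬝ᵥ e) * (n ⬝ᵥ n) := by
  rw [cross_normal_cross h, dotProduct_smul, smul_eq_mul]

end Basic

/-! ### The decomposition `z = α (e × n) + w e` -/

section Decomp

variable {e n : Fin 3 → ℝ}

/-- Orthogonality / pairing identity `dot_cplx_e_cross`. [folklore] -/
theorem dot_cplx_e_cross (e n : Fin 3 → ℝ) : dot (cplx e) (cplx (e ⨯₃ n)) = 0 := by
  rw [dot_cplx_cplx, dot_self_cross]; simp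

/-- Orthogonality / pairing identity `dot_cplx_cross_e`. [folklore] -/
theorem dot_cplx_cross_e (e n : Fin 3 → ℝ) : dot (cplx (e ⨯₃ n)) (cplx e) = 0 := by
  rw [dot_comm, dot_cplx_e_cross]

/-- Orthogonality / pairing identity `dot_cplx_n_cross`. [folklore] -/
theorem dot_cplx_n_cross (e n : Fin 3 → ℝ) : dot (cplx n) (cplx (e ⨯₃ n)) = 0 := by
  rw [dot_cplx_cplx, dot_cross_self]; simp

/-- Orthogonality / pairing identity `dot_cplx_n_e`. [folklore] -/
theorem dot_cplx_n_e (h : e ⬝ᵥ n = 0) : dot (cplx n) (cplx e) = 0 := by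
  rw [dot_cplx_cplx, dotProduct_comm, h]; simp

/-- Orthogonality / pairing identity `dot_cplx_e_n`. [folklore] -/
theorem dot_cplx_e_n (h : e ⬝ᵥ n = 0) : dot (cplx e) (cplx n) = 0 := by
  rw [dot_cplx_cplx, h]; simp

/-- `e · (w e) = w |e|²`: the vertical coordinate of `z` recovers `e·z`. [folklore] -/
theorem vert_mul (he : e ≠ 0) (z : Fin 3 → ℂ) : vert e z * dot (cplx e) (cplx e) = dot (cplx e) z := by
  unfold vert; rw [div_mul_cancel₀ _ (dot_cplx_self_ne_zero he)]

/-- Coordinate identity `hcoef_mul`. [folklore] -/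
theorem hcoef_mul (hk : e ⨯₃ n ≠ 0) (z : Fin 3 → ℂ) :
    hcoef e n z * dot (cplx (e ⨯₃ n)) (cplx (e ⨯₃ n)) = dot (cplx (e ⨯₃ n)) z := by
  unfold hcoef; rw [div_mul_cancel₀ _ (dot_cplx_self_ne_zero hk)]

/-- The horizontal part is horizontal: `e · horiz z = 0`. [folklore] -/
theorem dot_e_horiz (he : e ≠ 0) (z : Fin 3 → ℂ) : dot (cplx e) (horiz e z) = 0 := by
  unfold horiz; rw [dot_sub_right, dot_smul_right, vert_mul he, sub_self]

/-- **The decomposition `u_n = α_n (e × n) + w_n e`** of a divergence-free coefficient vector at a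
planar frequency. [cite: KishimotoYoneda2022, §3 (`u = u^∥ + u^⊥e^⊥`, `u^∥_n = α_n e^∥_n`)] -/
theorem decomp (he : e ≠ 0) (hn : n ≠ 0) (h : e ⬝ᵥ n = 0) {z : Fin 3 → ℂ} (hdiv : dot (cplx n) z = 0) :
    z = hcoef e n z • cplx (e ⨯₃ n) + vert e z • cplx e := by
  have hk := cross_normal_ne_zero he hn h
  rw [← sub_eq_zero]
  apply eq_zero_of_dot_triple (b₁ := n) (b₂ := e ⨯₃ n) (b₃ := e)
  · rw [triple_frame h]
    exact mul_ne_zero (real_dot_self_ne_zero he) (real_dot_self_ne_zero hn)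
  · rw [dot_sub_right, dot_add_right, dot_smul_right, dot_smul_right, hdiv, dot_cplx_n_cross,
      dot_cplx_n_e h, mul_zero, mul_zero, add_zero, sub_zero]
  · rw [dot_sub_right, dot_add_right, dot_smul_right, dot_smul_right, hcoef_mul hk, dot_cplx_cross_e,
      mul_zero, add_zero, sub_self]
  · rw [dot_sub_right, dot_add_right, dot_smul_right, dot_smul_right, dot_cplx_e_cross, vert_mul he,
      mul_zero, zero_add, sub_self]

/-- The horizontal part of a divergence-free vector at a planar frequency is `α (e × n)`.
[cite: KishimotoYoneda2022, §3 (`u^∥_n = α_n e^∥_n`)] -/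
theorem horiz_eq (he : e ≠ 0) (hn : n ≠ 0) (h : e ⬝ᵥ n = 0) {z : Fin 3 → ℂ} (hdiv : dot (cplx n) z = 0) :
    horiz e z = hcoef e n z • cplx (e ⨯₃ n) := by
  have hd := decomp he hn h hdiv
  unfold horiz
  rw [sub_eq_iff_eq_add]
  exact hd

/-- Linearity of the vertical coordinate. [folklore] -/
theorem vert_add (e : Fin 3 → ℝ) (z z' : Fin 3 → ℂ) : vert e (z + z') = vert e z + vert e z' := by
  unfold vert; rw [dot_add_right, add_div]

/-- Linearity rule `vert_smul`. [folklore] -/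
theorem vert_smul (e : Fin 3 → ℝ) (c : ℂ) (z : Fin 3 → ℂ) : vert e (c • z) = c * vert e z := by
  unfold vert; rw [dot_smul_right, mul_div_assoc]

/-- Linearity rule `vert_sub`. [folklore] -/
theorem vert_sub (e : Fin 3 → ℝ) (z z' : Fin 3 → ℂ) : vert e (z - z') = vert e z - vert e z' := by
  unfold vert; rw [dot_sub_right, sub_div]

/-- Simp bookkeeping: `vert_zero`. [folklore] -/
@[simp] theorem vert_zero (e : Fin 3 → ℝ) : vert e 0 = 0 := by unfold vert; simp

/-- Linearity rule `vert_sum`. [folklore] -/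
theorem vert_sum {ι : Type*} (e : Fin 3 → ℝ) (s : Finset ι) (f : ι → Fin 3 → ℂ) :
    vert e (∑ i ∈ s, f i) = ∑ i ∈ s, vert e (f i) := by
  unfold vert; rw [dot_sum_right]; simp only [div_eq_mul_inv, Finset.sum_mul]

/-- Coordinate identity `vert_cplx_e`. [folklore] -/
theorem vert_cplx_e (he : e ≠ 0) : vert e (cplx e) = 1 := by
  unfold vert; rw [div_self (dot_cplx_self_ne_zero he)]

/-- Coordinate identity `vert_cplx_cross`. [folklore] -/
theorem vert_cplx_cross (e n : Fin 3 → ℝ) : vert e (cplx (e ⨯₃ n)) = 0 := by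
  unfold vert; rw [dot_cplx_e_cross, zero_div]

/-- Coordinate identity `vert_cplx_planar`. [folklore] -/
theorem vert_cplx_planar (h : e ⬝ᵥ n = 0) : vert e (cplx n) = 0 := by
  unfold vert; rw [dot_cplx_e_n h, zero_div]

/-- Linearity of the horizontal part. [folklore] -/
theorem horiz_add (e : Fin 3 → ℝ) (z z' : Fin 3 → ℂ) : horiz e (z + z') = horiz e z + horiz e z' := by
  unfold horiz; rw [vert_add, add_smul]; abel

/-- Linearity rule `horiz_smul`. [folklore] -/
theorem horiz_smul (e : Fin 3 → ℝ) (c : ℂ) (z : Fin 3 → ℂ) : horiz e (c • z) = c • horiz e z := by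
  unfold horiz; rw [vert_smul, smul_sub, smul_smul]

/-- Linearity rule `horiz_neg`. [folklore] -/
theorem horiz_neg (e : Fin 3 → ℝ) (z : Fin 3 → ℂ) : horiz e (-z) = -horiz e z := by
  rw [show -z = (-1 : ℂ) • z by simp, horiz_smul]; simp

/-- Linearity rule `horiz_sub`. [folklore] -/
theorem horiz_sub (e : Fin 3 → ℝ) (z z' : Fin 3 → ℂ) : horiz e (z - z') = horiz e z - horiz e z' := by
  rw [sub_eq_add_neg, horiz_add, horiz_neg, ← sub_eq_add_neg]

/-- Simp bookkeeping: `horiz_zero`. [folklore] -/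
@[simp] theorem horiz_zero (e : Fin 3 → ℝ) : horiz e 0 = 0 := by unfold horiz; simp

/-- Linearity rule `horiz_sum`. [folklore] -/
theorem horiz_sum {ι : Type*} (e : Fin 3 → ℝ) (s : Finset ι) (f : ι → Fin 3 → ℂ) :
    horiz e (∑ i ∈ s, f i) = ∑ i ∈ s, horiz e (f i) := by
  classical
  induction s using Finset.induction_on with
  | empty => simp
  | insert a s ha ih => rw [Finset.sum_insert ha, Finset.sum_insert ha, horiz_add, ih]

/-- The vertical part is real-linear under conjugation: `vert e (star z) = star (vert e z)`. [folklore] -/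
theorem vert_star (e : Fin 3 → ℝ) (z : Fin 3 → ℂ) : vert e (star z) = star (vert e z) := by
  unfold vert
  rw [star_div₀]
  congr 1
  · simp [dot_eq, cplx_apply]
  · rw [dot_cplx_cplx]; simp

/-- Coordinate identity `horiz_star`. [folklore] -/
theorem horiz_star (e : Fin 3 → ℝ) (z : Fin 3 → ℂ) : horiz e (star z) = star (horiz e z) := by
  unfold horiz
  rw [vert_star, star_sub, star_smul, star_cplx]

/-- The Helmholtz projection at a planar frequency commutes with the vertical coordinate:
`e · P̂_n X = e · X`. [cite: KishimotoYoneda2022, §3 ("the vertical component of (cond:Euler)")] -/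
theorem vert_proj (h : e ⬝ᵥ n = 0) (X : Fin 3 → ℂ) : vert e (proj n X) = vert e X := by
  unfold proj; rw [vert_sub, vert_smul, vert_cplx_planar h, mul_zero, sub_zero]

/-- … and with the horizontal part: `horiz (P̂_n X) = P̂_n (horiz X)`.
[cite: KishimotoYoneda2022, §3 ("take the horizontal component of (cond:Euler)")] -/
theorem horiz_proj (h : e ⬝ᵥ n = 0) (X : Fin 3 → ℂ) : horiz e (proj n X) = proj n (horiz e X) := by
  unfold proj
  rw [horiz_sub, horiz_smul]
  unfold horiz
  rw [dot_sub_right, dot_smul_right, dot_cplx_n_e h, mul_zero, sub_zero, vert_cplx_planar h, zero_smul,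
    sub_zero]

end Decomp

/-! ### The pair bracket in planar coordinates -/

section Bracket

variable {e n₁ n₂ : Fin 3 → ℝ} {u₁ u₂ : Fin 3 → ℂ} {α₁ α₂ w₁ w₂ : ℂ}

/-- `u·n' = α τ(n, n')` for `u = α (e × n) + w e` and planar `n'`. [cite: KishimotoYoneda2022, §3] -/
theorem dot_decomp_planar (h₂ : e ⬝ᵥ n₂ = 0) (hu₁ : u₁ = α₁ • cplx (e ⨯₃ n₁) + w₁ • cplx e) :
    dot u₁ (cplx n₂) = α₁ * ((pc e n₁ n₂ : ℝ) : ℂ) := by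
  rw [hu₁, dot_add_left, dot_smul_left, dot_smul_left, dot_cplx_cplx, dot_cplx_cplx, h₂,
    ← pc_eq_cross_dot]
  simp

/-- **The bracket in planar coordinates**: `(u₁·n₂)u₂ + (u₂·n₁)u₁ = τ₁₂ (α₁ u₂ - α₂ u₁)`.
[cite: KishimotoYoneda2022, §3 ((cond:parallel), (cond:Euler^h))] -/
theorem bracket_planar (h₁ : e ⬝ᵥ n₁ = 0) (h₂ : e ⬝ᵥ n₂ = 0)
    (hu₁ : u₁ = α₁ • cplx (e ⨯₃ n₁) + w₁ • cplx e) (hu₂ : u₂ = α₂ • cplx (e ⨯₃ n₂) + w₂ • cplx e) :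
    bracket n₁ n₂ u₁ u₂ = ((pc e n₁ n₂ : ℝ) : ℂ) • (α₁ • u₂ - α₂ • u₁) := by
  unfold bracket
  rw [dot_decomp_planar h₂ hu₁, dot_decomp_planar h₁ hu₂, pc_anticomm e n₁ n₂]
  push_cast
  rw [smul_sub, smul_smul, smul_smul, mul_comm _ α₁, mul_comm _ α₂]
  simp [sub_eq_add_neg, neg_smul, mul_neg]

/-- The vertical coordinate of the bracket: `τ₁₂ (α₁ w₂ - α₂ w₁)`.
[cite: KishimotoYoneda2022, §3 (cond:Euler^h)] -/
theorem vert_bracket_planar (he : e ≠ 0) (h₁ : e ⬝ᵥ n₁ = 0) (h₂ : e ⬝ᵥ n₂ = 0)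
    (hu₁ : u₁ = α₁ • cplx (e ⨯₃ n₁) + w₁ • cplx e) (hu₂ : u₂ = α₂ • cplx (e ⨯₃ n₂) + w₂ • cplx e) :
    vert e (bracket n₁ n₂ u₁ u₂) = ((pc e n₁ n₂ : ℝ) : ℂ) * (α₁ * w₂ - α₂ * w₁) := by
  rw [bracket_planar h₁ h₂ hu₁ hu₂, vert_smul, vert_sub, vert_smul, vert_smul]
  have hv₁ : vert e u₁ = w₁ := by
    rw [hu₁, vert_add, vert_smul, vert_smul, vert_cplx_cross, vert_cplx_e he]; ring
  have hv₂ : vert e u₂ = w₂ := by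
    rw [hu₂, vert_add, vert_smul, vert_smul, vert_cplx_cross, vert_cplx_e he]; ring
  rw [hv₁, hv₂]

/-- The horizontal part of the bracket is the bracket of the horizontal parts.
[cite: KishimotoYoneda2022, §3 ("`u^∥` is in itself a solution of (cond:Euler)")] -/
theorem horiz_bracket_planar (he : e ≠ 0) (h₁ : e ⬝ᵥ n₁ = 0) (h₂ : e ⬝ᵥ n₂ = 0)
    (hu₁ : u₁ = α₁ • cplx (e ⨯₃ n₁) + w₁ • cplx e) (hu₂ : u₂ = α₂ • cplx (e ⨯₃ n₂) + w₂ • cplx e) :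
    horiz e (bracket n₁ n₂ u₁ u₂)
      = bracket n₁ n₂ (α₁ • cplx (e ⨯₃ n₁)) (α₂ • cplx (e ⨯₃ n₂)) := by
  have hh₁ : horiz e u₁ = α₁ • cplx (e ⨯₃ n₁) := by
    unfold horiz
    rw [hu₁, vert_add, vert_smul, vert_smul, vert_cplx_cross, vert_cplx_e he]
    simp
  have hh₂ : horiz e u₂ = α₂ • cplx (e ⨯₃ n₂) := by
    unfold horiz
    rw [hu₂, vert_add, vert_smul, vert_smul, vert_cplx_cross, vert_cplx_e he]
    simp
  rw [bracket_planar h₁ h₂ hu₁ hu₂, horiz_smul, horiz_sub, horiz_smul, horiz_smul, hh₁, hh₂,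
    bracket_planar (α₁ := α₁) (α₂ := α₂) (w₁ := 0) (w₂ := 0) h₁ h₂ (by rw [zero_smul, add_zero])
      (by rw [zero_smul, add_zero])]

end Bracket

end KY

end Literature.Analysis.FluidPDE
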